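import Literature.AlgebraicGeometry.Surfaces.KummerLatticeDiscriminantForm
import Literature.AlgebraicGeometry.Surfaces.NikulinLattice
import HarnessLib

/-!
# The discriminant form of the Nikulin lattice: `(A_{U(2)^{⊕3}}, q) ≅ (A_N, -q_N)` (`= (A_N, q_N)`)
# (van Geemen–Sarti, *Nikulin involutions on K3 surfaces*, §1.10)

[cite: VanGeemenSarti2007, §1.10 (proof of Lemma 1.10)] [cite: Huybrechts2016K3, Ch. 14 §0.1, §0.2]

Family `hodge`, layer `Literature/AlgebraicGeometry/Surfaces` (namespace `Literature.AlgebraicGeometry.Surfaces`).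
Written for lane `lit-hodgefound` (Track 2 foundations; prover seat `lit-hodgefound-p18`, gen 29, row g29-#2), as the
sequel of `NikulinLattice.lean` (gen 28, g28-#7/#13), whose module docstring lists "the isometry class
`q_N ≅ -q_{U(2)^{⊕3}}`" as NOT there, and the companion of `KummerLatticeDiscriminantForm.lean` (g29-#1, same
architecture for the Kummer lattice). DEFINITIONS WITH BODIES (the six quadruple vectors of Lemma 1.10, a lift
`U^{⊕3} → ⊕ ℤNᵢ`, the functionals `U^{⊕3} → N^*`, the comparison map `A_{U(2)^{⊕3}} → A_N` and the isomorphism) and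
THEOREMS; no named fact, no instance, no notation.

## Source, verbatim

B. van Geemen, A. Sarti, *Nikulin involutions on K3 surfaces*, Math. Z. 255 (2007) 731–753, §1.10 (held
`paper:arxiv-math_0602015`, p. 4). Lemma 1.10: "The sublattice of `(U(2)³ ⊕ N) ⊗ ℚ` generated by `U(2)³ ⊕ N` and
the following six elements, each divided by two, is isomorphic to `U³ ⊕ E₈(-1)`:
`e₁ + (N₁+N₂+N₃+N₈)`, `e₂ + (N₁+N₅+N₆+N₈)`, `e₃ + (N₂+N₆+N₇+N₈)`, `f₁ + (N₁+N₂+N₄+N₈)`, `f₂ + (N₁+N₅+N₇+N₈)`,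
`f₃ + (N₃+N₄+N₅+N₈)`, here `eᵢ, fᵢ` are the standard basis of the `i`-th copy of `U(2)` in `U(2)³`." Proof, loc. cit.:
"In our case `M = K ⊕ N`, with `K = U(2)³` […] We will see that `(A_K, q_K) ≅ (A_N, -q_N)` […] isomorphisms
`γ : A_N → A_K` with `q_N = -q_K ∘ γ`. […] Thus `A_K = (U(2)^*/U(2))³ ≅ (ℤ/2ℤ)⁶`, and the discriminant form `q_K`
on `A_K` is given by `q_K : A_K = (ℤ/2ℤ)⁶ → ℤ/2ℤ`, `q_K(x) = x₁x₂ + x₃x₄ + x₅x₆`. […]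
`A_N = N^*/N = {(x₁,…,x₈) ∈ (ℤ/2ℤ)⁸ : Σ xᵢ = 0}/⟨(1,…,1)⟩ ≅ (ℤ/2ℤ)⁶` […] The quadratic spaces, over the field
`ℤ/2ℤ`, `((ℤ/2ℤ)⁶, q_K)` and `((ℤ/2ℤ)⁶, q_N)` are isomorphic, an explicit isomorphism is defined by
`γ : A_N → A_K`, `γ((N₁+N₂+N₃+N₈)/2) = e₁/2`, etc. where we use the six elements listed in the lemma." And §2.1
(p. 5): "`q_N` of the lattice `N` has values in `ℤ/2ℤ`, hence `q_N = -q_N`."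

## The argument (as in `KummerLatticeDiscriminantForm.lean`)

`Λ = ⊕ ℤNᵢ = ⟨-2⟩⁸`, `Λ^* = ⊕ ℤ(Nᵢ/2)` (`Σ yᵢ Nᵢ/2 ↔ nikulinBaseForm y`), `N ⊂ N^* ⊂ Λ^*`, "`n^* = Σ xᵢ(Nᵢ/2)` is in
`N^*` iff `Σ xᵢ ≡ 0 mod 2`" (`NikulinLattice.lean`).
* §1 `b_Λ`, `q_Λ` on `A_Λ`: `(Σ xᵢNᵢ/2 . Σ yᵢNᵢ/2) = -(x·y)/2`.
* §2 **the six quadruples** `e₁ ↔ (N₁+N₂+N₃+N₈)/2`, `e₂ ↔ (N₁+N₅+N₆+N₈)/2`, `e₃ ↔ (N₂+N₆+N₇+N₈)/2`,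
  `f₁ ↔ (N₁+N₂+N₄+N₈)/2`, `f₂ ↔ (N₁+N₅+N₇+N₈)/2`, `f₃ ↔ (N₃+N₄+N₅+N₈)/2` as `{0,1}`-vectors of `ℤ⁸`; two distinct
  quadruples meet in `2` indices except `eₜ, fₜ`, which meet in `3`, `3`, `1` indices (`t = 1, 2, 3`): so
  `b(eₛ, fₜ) = -|∩|/2 ≡ ½ δₛₜ`, all other `b ≡ 0 mod ℤ`, `q ≡ -4/2 ≡ 0 mod 2ℤ` — the form of `U(2)³` (and of `-U(2)³`).
* §3 the comparison map `ψ : A_{U(2)³} → A_N`, `w/2 ↦ [½ Σₜ (uₜ eₜ + vₜ fₜ)]`, the defect form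
  `δ(w, w') = (w . w')_U + lift w · lift w'` with `2 ∣ δ`, `4 ∣ δ(w, w)` (basis values + the Gram-matrix lemmas of
  `KummerLatticeDiscriminantForm.lean` §0); hence `b_N(ψ a, ψ c) = b_U(a, c) = -b_U(a, c)` and
  `q_N(ψ a) = q_U(a) = -q_U(a)` (the values lie in `½ℤ/ℤ` resp. `ℤ/2ℤ`).
* §4 `ψ` injective (nondegeneracy of `b_U`), `|A_{U(2)³}| = |A_N| = 2⁶`, so **`nikulinDiscriminantIso : A_{U(2)³} ⥲ A_N`**;
  van Geemen–Sarti's `γ = ψ⁻¹ : A_N ⥲ A_K` with **`q_N = -q_K ∘ γ`** (`exists_vanGeemenSarti_gamma`); `q_N = -q_N`;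
  and, with g29-#1, `(A_N, q_N) ≅ (A_K, q_K)` for the KUMMER lattice `K` (both `≅ q_{U(2)}^{⊕3}`).

NOT here: the uniqueness statements of §1.10 (`O(q_N) ≅ S₈`, "any two isomorphisms … differ by an isometry of `A_N`
induced by a permutation of the nodal classes") and Lemma 1.10 itself (`NikulinLatticeGluing.lean`).

## References

* [VanGeemenSarti2007] B. van Geemen, A. Sarti, Nikulin involutions on K3 surfaces, Math. Z. 255 (2007), §1.10, §2.1.
* [Huybrechts2016K3] D. Huybrechts, Lectures on K3 Surfaces, CUP 2016, Ch. 14 §0.1–§0.2, Ch. 15 §4.1.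
* [Nikulin1980] V. V. Nikulin, Math. USSR Izv. 14 (1980), Prop. 1.4.1 (through `LatticeFormsOverlattices.lean`).
-/

noncomputable section

open Module Function Matrix
open LinearMap (BilinForm)
open LinearMap.BilinForm
open Literature.Topology.FourManifolds

namespace Literature.AlgebraicGeometry.Surfaces

/-! ### §1 `b_Λ`, `q_Λ` on `A_Λ`, `Λ = ⊕ ℤNᵢ = ⟨-2⟩⁸`; `N^* ↪ Λ^*` -/

/-- `(Σ xᵢNᵢ/2 . Σ yᵢNᵢ/2)_{Λ_ℚ} = -(x·y)/2` (`(Nᵢ/2)² = -½`). [cite: VanGeemenSarti2007, §1.10 ("`Nᵢ² = -2`, hence `N^* ⊂ ℤ(Nᵢ/2)`")] -/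
theorem dualForm_nikulinBaseForm_nikulinBaseForm (x y : Fin 8 → ℤ) :
    nikulinNodeForm.dualForm (nikulinBaseForm x) (nikulinBaseForm y) = -((x ⬝ᵥ y : ℤ) : ℚ) / 2 := by
  rw [nikulinBaseForm.dualForm_smul_apply_apply 2 nondegenerate_nikulinBaseForm two_ne_zero, nikulinBaseForm_apply,
    dotProduct_comm]
  push_cast
  ring

/-- **`b_Λ([Σ xᵢNᵢ/2], [Σ yᵢNᵢ/2]) = -(x·y)/2 mod ℤ`.** [cite: VanGeemenSarti2007, §1.10] [cite: Huybrechts2016K3, Ch. 14 §0.1 ("a pairing `A_Λ × A_Λ → ℚ/ℤ`")] -/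
theorem discriminantBilin_mk_nikulinBaseForm (x y : Fin 8 → ℤ) :
    nikulinNodeForm.discriminantBilin nondegenerate_nikulinNodeForm isSymm_nikulinNodeForm
        (Submodule.Quotient.mk (nikulinBaseForm x)) (Submodule.Quotient.mk (nikulinBaseForm y)) =
      ((-((x ⬝ᵥ y : ℤ) : ℚ) / 2 : ℚ) : AddCircle (1 : ℚ)) := by
  rw [discriminantBilin_mk_mk, dualForm_nikulinBaseForm_nikulinBaseForm]

/-- **`N^* ↪ Λ^* = ⊕ ℤ(Nᵢ/2)`**: restriction of functionals `N^* → Λ^*` is injective ("`N^* ⊂ ℤ(Nᵢ/2)`").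
[cite: VanGeemenSarti2007, §1.10 ("`N^* ⊂ ℤ(Nᵢ/2)`")] -/
theorem dualMap_nikulinLattice_injective :
    Injective (nikulinNodeForm.toOverlattice nikulinLattice range_nikulinNodeForm_le).dualMap :=
  nikulinNodeForm.dualMap_toOverlattice_injective nondegenerate_nikulinNodeForm isSymm_nikulinNodeForm _ _

/-- **The vectors `y ∈ ℤ⁸` with `Σ yᵢ(Nᵢ/2) ∈ N^*`**: "`Σ xᵢ ≡ 0 mod 2`", as a subgroup of `ℤ⁸`.
[cite: VanGeemenSarti2007, §1.10 ("`n^* = Σ xᵢ(Nᵢ/2)` with `Σ xᵢ ≡ 0 mod 2`")] -/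
def nikulinDualVectors : Submodule ℤ (Fin 8 → ℤ) where
  carrier := {y | (2 : ℤ) ∣ ∑ i, y i}
  add_mem' {x y} hx hy := by
    simp only [Set.mem_setOf_eq, Pi.add_apply, Finset.sum_add_distrib]
    exact dvd_add hx hy
  zero_mem' := by simp only [Set.mem_setOf_eq, Pi.zero_apply, Finset.sum_const_zero, dvd_zero]
  smul_mem' n {x} hx := by
    simp only [Set.mem_setOf_eq, Pi.smul_apply, smul_eq_mul, ← Finset.mul_sum]
    exact hx.mul_left n

/-- Unfolding `nikulinDualVectors`. [cite: VanGeemenSarti2007, §1.10] -/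
theorem mem_nikulinDualVectors_iff (y : Fin 8 → ℤ) : y ∈ nikulinDualVectors ↔ (2 : ℤ) ∣ ∑ i, y i :=
  Iff.rfl

/-- `Σ yᵢ(Nᵢ/2) ∈ N^*` iff `y ∈ nikulinDualVectors` (restating `mem_dual_nikulinLattice_iff`). [cite: VanGeemenSarti2007, §1.10] -/
theorem mem_dual_nikulinLattice_iff' (y : Fin 8 → ℤ) :
    nikulinBaseForm y ∈ LinearMap.range (nikulinNodeForm.toOverlattice nikulinLattice range_nikulinNodeForm_le).dualMap ↔
      y ∈ nikulinDualVectors :=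
  mem_dual_nikulinLattice_iff y

/-! ### §2 The six quadruples of Lemma 1.10 -/

/-- **The three "`e`-quadruples"** `N₁+N₂+N₃+N₈`, `N₁+N₅+N₆+N₈`, `N₂+N₆+N₇+N₈` (glued to `e₁, e₂, e₃`), as
`{0,1}`-vectors of `⊕ ℤNᵢ = ℤ⁸` (indices `0, …, 7` for `N₁, …, N₈`). [cite: VanGeemenSarti2007, Lemma 1.10] -/
def nikulinEVector : Fin 3 → Fin 8 → ℤ :=
  ![![1, 1, 1, 0, 0, 0, 0, 1], ![1, 0, 0, 0, 1, 1, 0, 1], ![0, 1, 0, 0, 0, 1, 1, 1]]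

/-- **The three "`f`-quadruples"** `N₁+N₂+N₄+N₈`, `N₁+N₅+N₇+N₈`, `N₃+N₄+N₅+N₈` (glued to `f₁, f₂, f₃`).
[cite: VanGeemenSarti2007, Lemma 1.10] -/
def nikulinFVector : Fin 3 → Fin 8 → ℤ :=
  ![![1, 1, 0, 1, 0, 0, 0, 1], ![1, 0, 0, 0, 1, 0, 1, 1], ![0, 0, 1, 1, 1, 0, 0, 1]]

/-- Each `e`-quadruple has four nodes: `Σᵢ (eₜ)ᵢ = 4`. [cite: VanGeemenSarti2007, Lemma 1.10] -/
theorem sum_nikulinEVector (t : Fin 3) : ∑ i, nikulinEVector t i = 4 := by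
  revert t
  decide

/-- Each `f`-quadruple has four nodes. [cite: VanGeemenSarti2007, Lemma 1.10] -/
theorem sum_nikulinFVector (t : Fin 3) : ∑ i, nikulinFVector t i = 4 := by
  revert t
  decide

/-- `eₛ · eₜ = 4` (`s = t`) or `2` (two common nodes). [cite: VanGeemenSarti2007, §1.10] -/
theorem nikulinEVector_dotProduct_nikulinEVector (s t : Fin 3) :
    nikulinEVector s ⬝ᵥ nikulinEVector t = if s = t then 4 else 2 := by
  revert s t
  decide

/-- `fₛ · fₜ = 4` (`s = t`) or `2`. [cite: VanGeemenSarti2007, §1.10] -/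
theorem nikulinFVector_dotProduct_nikulinFVector (s t : Fin 3) :
    nikulinFVector s ⬝ᵥ nikulinFVector t = if s = t then 4 else 2 := by
  revert s t
  decide

/-- `eₛ · fₜ`: the glued pairs `(eₜ, fₜ)` meet in `3`, `3`, `1` nodes, distinct pairs in `2` nodes.
[cite: VanGeemenSarti2007, §1.10] -/
theorem nikulinEVector_dotProduct_nikulinFVector (s t : Fin 3) :
    nikulinEVector s ⬝ᵥ nikulinFVector t = if s = t then ![3, 3, 1] s else 2 := by
  revert s t
  decide

/-- Parity form: `eₛ · fₜ + δₛₜ` is even. [cite: VanGeemenSarti2007, §1.10] -/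
theorem two_dvd_nikulinEVector_dotProduct_nikulinFVector_add (s t : Fin 3) :
    2 ∣ nikulinEVector s ⬝ᵥ nikulinFVector t + if s = t then 1 else 0 := by
  revert s t
  decide

/-- Parity form: `fₛ · eₜ + δₛₜ` is even. [cite: VanGeemenSarti2007, §1.10] -/
theorem two_dvd_nikulinFVector_dotProduct_nikulinEVector_add (s t : Fin 3) :
    2 ∣ nikulinFVector s ⬝ᵥ nikulinEVector t + if s = t then 1 else 0 := by
  revert s t
  decide

/-- **`½ eₜ ∈ N^*`** (four nodes, an even number). [cite: VanGeemenSarti2007, §1.10 ("`Σ xᵢ ≡ 0 mod 2`")] -/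
theorem nikulinEVector_mem_nikulinDualVectors (t : Fin 3) : nikulinEVector t ∈ nikulinDualVectors := by
  rw [mem_nikulinDualVectors_iff, sum_nikulinEVector]
  decide

/-- **`½ fₜ ∈ N^*`.** [cite: VanGeemenSarti2007, §1.10] -/
theorem nikulinFVector_mem_nikulinDualVectors (t : Fin 3) : nikulinFVector t ∈ nikulinDualVectors := by
  rw [mem_nikulinDualVectors_iff, sum_nikulinFVector]
  decide

/-! ### §3 The lift `U^{⊕3} → ⊕ ℤNᵢ`, the functionals `U^{⊕3} → N^*` and the comparison map `A_{U(2)^{⊕3}} → A_N` -/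

/-- **The lift `w = (u, v) ↦ Σₜ uₜ eₜ + Σₜ vₜ fₜ ∈ ⊕ ℤNᵢ`** (halved: the `N`-components of the six glue vectors).
[cite: VanGeemenSarti2007, Lemma 1.10] -/
def nikulinQuadLift : ((Fin 3 → ℤ) × (Fin 3 → ℤ)) →ₗ[ℤ] (Fin 8 → ℤ) :=
  Fintype.linearCombination ℤ nikulinEVector ∘ₗ LinearMap.fst ℤ _ _ +
    Fintype.linearCombination ℤ nikulinFVector ∘ₗ LinearMap.snd ℤ _ _

/-- `lift (u, v) = Σₜ uₜ eₜ + Σₜ vₜ fₜ`. [cite: VanGeemenSarti2007, Lemma 1.10] -/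
theorem nikulinQuadLift_apply (w : (Fin 3 → ℤ) × (Fin 3 → ℤ)) :
    nikulinQuadLift w = Fintype.linearCombination ℤ nikulinEVector w.1 + Fintype.linearCombination ℤ nikulinFVector w.2 :=
  rfl

/-- `lift (eₛ) = eₛ`. [cite: VanGeemenSarti2007, Lemma 1.10] -/
theorem nikulinQuadLift_inl (s : Fin 3) : nikulinQuadLift (Pi.single s 1, 0) = nikulinEVector s := by
  simp only [nikulinQuadLift, LinearMap.add_apply, LinearMap.comp_apply, LinearMap.fst_apply, LinearMap.snd_apply,
    Fintype.linearCombination_apply_single, one_smul, map_zero, add_zero]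

/-- `lift (fₛ) = fₛ`. [cite: VanGeemenSarti2007, Lemma 1.10] -/
theorem nikulinQuadLift_inr (s : Fin 3) : nikulinQuadLift (0, Pi.single s 1) = nikulinFVector s := by
  simp only [nikulinQuadLift, LinearMap.add_apply, LinearMap.comp_apply, LinearMap.fst_apply, LinearMap.snd_apply,
    Fintype.linearCombination_apply_single, one_smul, map_zero, zero_add]

/-- `Σₜ uₜ eₜ` halves into `N^*`. [cite: VanGeemenSarti2007, §1.10] -/
theorem linearCombination_nikulinEVector_mem_nikulinDualVectors (u : Fin 3 → ℤ) :
    Fintype.linearCombination ℤ nikulinEVector u ∈ nikulinDualVectors := by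
  have h : LinearMap.range (Fintype.linearCombination ℤ nikulinEVector) ≤ nikulinDualVectors := by
    rw [Fintype.range_linearCombination, Submodule.span_le]
    rintro _ ⟨t, rfl⟩
    exact nikulinEVector_mem_nikulinDualVectors t
  exact h (LinearMap.mem_range_self _ u)

/-- `Σₜ vₜ fₜ` halves into `N^*`. [cite: VanGeemenSarti2007, §1.10] -/
theorem linearCombination_nikulinFVector_mem_nikulinDualVectors (u : Fin 3 → ℤ) :
    Fintype.linearCombination ℤ nikulinFVector u ∈ nikulinDualVectors := by
  have h : LinearMap.range (Fintype.linearCombination ℤ nikulinFVector) ≤ nikulinDualVectors := by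
    rw [Fintype.range_linearCombination, Submodule.span_le]
    rintro _ ⟨t, rfl⟩
    exact nikulinFVector_mem_nikulinDualVectors t
  exact h (LinearMap.mem_range_self _ u)

/-- **`½ lift(w) ∈ N^*`.** [cite: VanGeemenSarti2007, §1.10] -/
theorem nikulinQuadLift_mem_nikulinDualVectors (w : (Fin 3 → ℤ) × (Fin 3 → ℤ)) :
    nikulinQuadLift w ∈ nikulinDualVectors := by
  rw [nikulinQuadLift_apply]
  exact add_mem (linearCombination_nikulinEVector_mem_nikulinDualVectors w.1)
    (linearCombination_nikulinFVector_mem_nikulinDualVectors w.2)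

/-- `nikulinBaseForm (lift w)` lies in the image of `N^* ↪ Λ^*`. [cite: VanGeemenSarti2007, §1.10] -/
theorem nikulinBaseForm_nikulinQuadLift_mem_range (w : (Fin 3 → ℤ) × (Fin 3 → ℤ)) :
    nikulinBaseForm (nikulinQuadLift w) ∈
      LinearMap.range (nikulinNodeForm.toOverlattice nikulinLattice range_nikulinNodeForm_le).dualMap :=
  (mem_dual_nikulinLattice_iff _).2 (nikulinQuadLift_mem_nikulinDualVectors w)

/-- **The functionals `w ↦ (½ lift(w) . _) ∈ N^*`** as a `ℤ`-linear map `U^{⊕3} → N^*`. [cite: VanGeemenSarti2007, §1.10] -/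
def nikulinQuadDual : ((Fin 3 → ℤ) × (Fin 3 → ℤ)) →ₗ[ℤ] Module.Dual ℤ nikulinLattice :=
  (LinearEquiv.ofInjective _ dualMap_nikulinLattice_injective).symm.toLinearMap ∘ₗ
    LinearMap.codRestrict (LinearMap.range (nikulinNodeForm.toOverlattice nikulinLattice range_nikulinNodeForm_le).dualMap)
      ((nikulinBaseForm : (Fin 8 → ℤ) →ₗ[ℤ] Module.Dual ℤ (Fin 8 → ℤ)) ∘ₗ nikulinQuadLift)
      nikulinBaseForm_nikulinQuadLift_mem_range

/-- **`(θ_w)|_Λ = nikulinBaseForm (lift w)`.** [cite: VanGeemenSarti2007, §1.10] -/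
theorem dualMap_nikulinQuadDual (w : (Fin 3 → ℤ) × (Fin 3 → ℤ)) :
    (nikulinNodeForm.toOverlattice nikulinLattice range_nikulinNodeForm_le).dualMap (nikulinQuadDual w) =
      nikulinBaseForm (nikulinQuadLift w) :=
  LinearEquiv.ofInjective_symm_apply (h := dualMap_nikulinLattice_injective) _ _

/-- **The defect form `δ(w, w') = (w . w')_U + lift(w) · lift(w')` on `U^{⊕3}`.** [cite: VanGeemenSarti2007, §1.10] -/
def nikulinQuadDefect : BilinForm ℤ ((Fin 3 → ℤ) × (Fin 3 → ℤ)) :=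
  hyperbolicSum 3 - nikulinBaseForm.comp nikulinQuadLift nikulinQuadLift

/-- `δ(w, w') = (w . w')_U + lift(w) · lift(w')`. [cite: VanGeemenSarti2007, §1.10] -/
theorem nikulinQuadDefect_apply (w w' : (Fin 3 → ℤ) × (Fin 3 → ℤ)) :
    nikulinQuadDefect w w' = hyperbolicSum 3 w w' + nikulinQuadLift w ⬝ᵥ nikulinQuadLift w' := by
  rw [nikulinQuadDefect, LinearMap.sub_apply, LinearMap.sub_apply, LinearMap.BilinForm.comp_apply, nikulinBaseForm_apply,
    sub_neg_eq_add]

/-- `δ` is symmetric. [cite: VanGeemenSarti2007, §1.10] -/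
theorem isSymm_nikulinQuadDefect : nikulinQuadDefect.IsSymm :=
  ⟨fun w w' ↦ by rw [nikulinQuadDefect_apply, nikulinQuadDefect_apply, (isSymm_hyperbolicSum 3).eq, dotProduct_comm]⟩

/-- **The values of `δ` on the basis `(eₛ; fₛ)` are even.** [cite: VanGeemenSarti2007, §1.10] -/
theorem two_dvd_nikulinQuadDefect_basis (i j : Fin 3 ⊕ Fin 3) :
    2 ∣ nikulinQuadDefect (((Pi.basisFun ℤ (Fin 3)).prod (Pi.basisFun ℤ (Fin 3))) i)
      (((Pi.basisFun ℤ (Fin 3)).prod (Pi.basisFun ℤ (Fin 3))) j) := by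
  rcases i with s | s <;> rcases j with t | t
  · rw [prod_basisFun_inl, prod_basisFun_inl, nikulinQuadDefect_apply, nikulinQuadLift_inl, nikulinQuadLift_inl,
      hyperbolicSum_inl_inl, nikulinEVector_dotProduct_nikulinEVector, zero_add]
    split_ifs <;> decide
  · rw [prod_basisFun_inl, prod_basisFun_inr, nikulinQuadDefect_apply, nikulinQuadLift_inl, nikulinQuadLift_inr,
      hyperbolicSum_inl_inr, add_comm]
    exact two_dvd_nikulinEVector_dotProduct_nikulinFVector_add s t
  · rw [prod_basisFun_inr, prod_basisFun_inl, nikulinQuadDefect_apply, nikulinQuadLift_inr, nikulinQuadLift_inl,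
      (isSymm_hyperbolicSum 3).eq, hyperbolicSum_inl_inr, add_comm]
    by_cases hst : s = t
    · subst hst
      rw [if_pos rfl]
      have h := two_dvd_nikulinFVector_dotProduct_nikulinEVector_add s s
      rwa [if_pos rfl] at h
    · rw [if_neg (Ne.symm hst)]
      have h := two_dvd_nikulinFVector_dotProduct_nikulinEVector_add s t
      rwa [if_neg hst] at h
  · rw [prod_basisFun_inr, prod_basisFun_inr, nikulinQuadDefect_apply, nikulinQuadLift_inr, nikulinQuadLift_inr,
      hyperbolicSum_inr_inr, nikulinFVector_dotProduct_nikulinFVector, zero_add]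
    split_ifs <;> decide

/-- **The diagonal values of `δ` on the basis are `≡ 0 mod 4`** (`eₛ² = fₛ² = 4` nodes, `(eₛ . eₛ)_U = 0`).
[cite: VanGeemenSarti2007, §1.10 ("`(e/2)² = (f/2)² = 0`")] -/
theorem four_dvd_nikulinQuadDefect_basis (i : Fin 3 ⊕ Fin 3) :
    4 ∣ nikulinQuadDefect (((Pi.basisFun ℤ (Fin 3)).prod (Pi.basisFun ℤ (Fin 3))) i)
      (((Pi.basisFun ℤ (Fin 3)).prod (Pi.basisFun ℤ (Fin 3))) i) := by
  rcases i with s | s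
  · rw [prod_basisFun_inl, nikulinQuadDefect_apply, nikulinQuadLift_inl, hyperbolicSum_inl_inl,
      nikulinEVector_dotProduct_nikulinEVector, if_pos rfl, zero_add]
  · rw [prod_basisFun_inr, nikulinQuadDefect_apply, nikulinQuadLift_inr, hyperbolicSum_inr_inr,
      nikulinFVector_dotProduct_nikulinFVector, if_pos rfl, zero_add]

/-- **`2 ∣ δ(w, w')`.** [cite: VanGeemenSarti2007, §1.10] -/
theorem two_dvd_nikulinQuadDefect (w w' : (Fin 3 → ℤ) × (Fin 3 → ℤ)) : 2 ∣ nikulinQuadDefect w w' :=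
  nikulinQuadDefect.dvd_apply_of_forall_dvd_apply_basis ((Pi.basisFun ℤ (Fin 3)).prod (Pi.basisFun ℤ (Fin 3)))
    two_dvd_nikulinQuadDefect_basis w w'

/-- **`4 ∣ δ(w, w)`.** [cite: VanGeemenSarti2007, §1.10] -/
theorem four_dvd_nikulinQuadDefect_self (w : (Fin 3 → ℤ) × (Fin 3 → ℤ)) : 4 ∣ nikulinQuadDefect w w :=
  nikulinQuadDefect.four_dvd_apply_self_of_basis ((Pi.basisFun ℤ (Fin 3)).prod (Pi.basisFun ℤ (Fin 3)))
    isSymm_nikulinQuadDefect two_dvd_nikulinQuadDefect_basis four_dvd_nikulinQuadDefect_basis w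

/-- **`b_N([θ_w], [θ_{w'}]) = -(lift w · lift w')/2 mod ℤ`** (Nikulin 1.4.1 (b)). [cite: VanGeemenSarti2007, §1.10] [cite: Nikulin1980, Prop. 1.4.1] -/
theorem discriminantBilin_nikulinForm_nikulinQuadDual (w w' : (Fin 3 → ℤ) × (Fin 3 → ℤ)) :
    nikulinForm.discriminantBilin nondegenerate_nikulinForm isSymm_nikulinForm (Submodule.Quotient.mk (nikulinQuadDual w))
        (Submodule.Quotient.mk (nikulinQuadDual w')) =
      ((-((nikulinQuadLift w ⬝ᵥ nikulinQuadLift w' : ℤ) : ℚ) / 2 : ℚ) : AddCircle (1 : ℚ)) := by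
  have h := nikulinNodeForm.discriminantBilin_integralForm_mk_mk nondegenerate_nikulinNodeForm isSymm_nikulinNodeForm
    nikulinLattice range_nikulinNodeForm_le nikulinLattice_integral (nikulinQuadDual w) (nikulinQuadDual w')
  rw [dualMap_nikulinQuadDual, dualMap_nikulinQuadDual, discriminantBilin_mk_nikulinBaseForm] at h
  exact h

/-- **`q_N([θ_w]) = -(lift w · lift w)/2 mod 2ℤ`.** [cite: VanGeemenSarti2007, §1.10] [cite: Nikulin1980, Prop. 1.4.1] -/
theorem discriminantQuad_nikulinForm_nikulinQuadDual (w : (Fin 3 → ℤ) × (Fin 3 → ℤ)) :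
    nikulinForm.discriminantQuad nondegenerate_nikulinForm isSymm_nikulinForm isEven_nikulinForm
        (Submodule.Quotient.mk (nikulinQuadDual w)) =
      ((-((nikulinQuadLift w ⬝ᵥ nikulinQuadLift w : ℤ) : ℚ) / 2 : ℚ) : AddCircle (2 : ℚ)) :=
  discriminantQuad_nikulinForm_mk (nikulinQuadDual w) (dualMap_nikulinQuadDual w)

/-- The auxiliary map `U^{⊕3} → A_N`, `w ↦ [θ_w]`. [cite: VanGeemenSarti2007, §1.10] -/
def nikulinQuadClass : ((Fin 3 → ℤ) × (Fin 3 → ℤ)) →ₗ[ℤ] nikulinForm.discriminantGroup :=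
  nikulinForm.discriminantGroupMkQ ∘ₗ nikulinQuadDual

/-- `nikulinQuadClass w = [θ_w]`. [cite: VanGeemenSarti2007, §1.10] -/
theorem nikulinQuadClass_apply (w : (Fin 3 → ℤ) × (Fin 3 → ℤ)) :
    nikulinQuadClass w = Submodule.Quotient.mk (nikulinQuadDual w) :=
  rfl

/-- `w ↦ [θ_w]` kills `i_{U(2)³}(U³) = 2·Hom(U³, ℤ)` (`2·A_N = 0`). [cite: VanGeemenSarti2007, §1.10 ("`A_N … ≅ (ℤ/2ℤ)⁶`")] -/
theorem range_two_smul_hyperbolicSum_le_ker_nikulinQuadClass :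
    LinearMap.range ((2 : ℤ) • hyperbolicSum 3) ≤
      LinearMap.ker (nikulinQuadClass ∘ₗ
        ((hyperbolicSum 3).dualEquivOfIsUnimodular (isUnimodular_hyperbolicSum 3)).symm.toLinearMap) := by
  rintro _ ⟨w, rfl⟩
  rw [LinearMap.mem_ker]
  change nikulinQuadClass (((hyperbolicSum 3).dualEquivOfIsUnimodular (isUnimodular_hyperbolicSum 3)).symm
    (((2 : ℤ) • hyperbolicSum 3) w)) = 0
  rw [LinearMap.smul_apply, map_smul, dualEquivOfIsUnimodular_symm_apply_apply, map_smul]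
  exact two_smul_discriminantGroup_nikulinForm _

/-- **The comparison map `ψ : A_{U(2)^{⊕3}} → A_N`, `eₜ/2 ↦ [(e-quadrupleₜ)/2]`, `fₜ/2 ↦ [(f-quadrupleₜ)/2]`** — the
inverse direction of van Geemen–Sarti's `γ : A_N → A_K`, "`γ((N₁+N₂+N₃+N₈)/2) = e₁/2`, etc.".
[cite: VanGeemenSarti2007, §1.10 ("an explicit isomorphism is defined by `γ : A_N → A_K`")] -/
def nikulinDiscriminantMap : ((2 : ℤ) • hyperbolicSum 3).discriminantGroup →ₗ[ℤ] nikulinForm.discriminantGroup :=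
  (LinearMap.range ((2 : ℤ) • hyperbolicSum 3)).liftQ
    (nikulinQuadClass ∘ₗ ((hyperbolicSum 3).dualEquivOfIsUnimodular (isUnimodular_hyperbolicSum 3)).symm.toLinearMap)
    range_two_smul_hyperbolicSum_le_ker_nikulinQuadClass

/-- **`ψ(w/2) = [θ_w]`.** [cite: VanGeemenSarti2007, §1.10] -/
theorem nikulinDiscriminantMap_mk (w : (Fin 3 → ℤ) × (Fin 3 → ℤ)) :
    nikulinDiscriminantMap (Submodule.Quotient.mk (hyperbolicSum 3 w)) = Submodule.Quotient.mk (nikulinQuadDual w) := by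
  change nikulinQuadClass (((hyperbolicSum 3).dualEquivOfIsUnimodular (isUnimodular_hyperbolicSum 3)).symm
    (hyperbolicSum 3 w)) = _
  rw [dualEquivOfIsUnimodular_symm_apply_apply, nikulinQuadClass_apply]

/-- **`b_N(ψ a, ψ c) = b_{U(2)³}(a, c)`** (`2 ∣ δ`). [cite: VanGeemenSarti2007, §1.10] -/
theorem discriminantBilin_nikulinDiscriminantMap (h₁ : ((2 : ℤ) • hyperbolicSum 3).Nondegenerate)
    (h₂ : ((2 : ℤ) • hyperbolicSum 3).IsSymm) (a c : ((2 : ℤ) • hyperbolicSum 3).discriminantGroup) :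
    nikulinForm.discriminantBilin nondegenerate_nikulinForm isSymm_nikulinForm (nikulinDiscriminantMap a)
        (nikulinDiscriminantMap c) = ((2 : ℤ) • hyperbolicSum 3).discriminantBilin h₁ h₂ a c := by
  obtain ⟨w, rfl⟩ := exists_mk_hyperbolicSum_eq 2 3 a
  obtain ⟨w', rfl⟩ := exists_mk_hyperbolicSum_eq 2 3 c
  rw [nikulinDiscriminantMap_mk, nikulinDiscriminantMap_mk, discriminantBilin_nikulinForm_nikulinQuadDual,
    ← twistIncl_mk, ← twistIncl_mk,
    (hyperbolicSum 3).discriminantBilin_smul_twistIncl_mk 2 (isUnimodular_hyperbolicSum 3).nondegenerate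
      (isSymm_hyperbolicSum 3) two_ne_zero h₁ h₂,
    ← sub_eq_zero, ← AddCircle.coe_sub, AddCircle.coe_eq_zero_iff]
  obtain ⟨k, hk⟩ := two_dvd_nikulinQuadDefect w w'
  rw [nikulinQuadDefect_apply] at hk
  refine ⟨-k, ?_⟩
  rw [zsmul_eq_mul, mul_one]
  have hk' : ((hyperbolicSum 3 w w' : ℤ) : ℚ) + (nikulinQuadLift w ⬝ᵥ nikulinQuadLift w' : ℤ) = 2 * k := by
    exact_mod_cast hk
  push_cast
  linarith

/-- **`b_N(ψ a, ψ c) = -b_{U(2)³}(a, c)`** as well: `b_{U(2)³}` takes values in `½ℤ/ℤ`, where `-b = b`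
("`(A_K, q_K) ≅ (A_N, -q_N)`"). [cite: VanGeemenSarti2007, §1.10 ("`(A_K,q_K) ≅ (A_N,-q_N)`")] -/
theorem discriminantBilin_nikulinDiscriminantMap_eq_neg (h₁ : ((2 : ℤ) • hyperbolicSum 3).Nondegenerate)
    (h₂ : ((2 : ℤ) • hyperbolicSum 3).IsSymm) (a c : ((2 : ℤ) • hyperbolicSum 3).discriminantGroup) :
    nikulinForm.discriminantBilin nondegenerate_nikulinForm isSymm_nikulinForm (nikulinDiscriminantMap a)
        (nikulinDiscriminantMap c) = -((2 : ℤ) • hyperbolicSum 3).discriminantBilin h₁ h₂ a c := by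
  rw [discriminantBilin_nikulinDiscriminantMap h₁ h₂]
  obtain ⟨w, rfl⟩ := exists_mk_hyperbolicSum_eq 2 3 a
  obtain ⟨w', rfl⟩ := exists_mk_hyperbolicSum_eq 2 3 c
  rw [← twistIncl_mk, ← twistIncl_mk,
    (hyperbolicSum 3).discriminantBilin_smul_twistIncl_mk 2 (isUnimodular_hyperbolicSum 3).nondegenerate
      (isSymm_hyperbolicSum 3) two_ne_zero h₁ h₂,
    ← sub_eq_zero, ← AddCircle.coe_neg, ← AddCircle.coe_sub, AddCircle.coe_eq_zero_iff]
  refine ⟨hyperbolicSum 3 w w', ?_⟩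
  rw [zsmul_eq_mul, mul_one]
  push_cast
  ring

/-- **`q_N(ψ a) = q_{U(2)³}(a)`** (`4 ∣ δ(w, w)`). [cite: VanGeemenSarti2007, §1.10 ("`((ℤ/2ℤ)⁶,q_K)` and `((ℤ/2ℤ)⁶,q_N)` are isomorphic")] -/
theorem discriminantQuad_nikulinDiscriminantMap (h₁ : ((2 : ℤ) • hyperbolicSum 3).Nondegenerate)
    (h₂ : ((2 : ℤ) • hyperbolicSum 3).IsSymm) (h₃ : ((2 : ℤ) • hyperbolicSum 3).IsEven)
    (a : ((2 : ℤ) • hyperbolicSum 3).discriminantGroup) :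
    nikulinForm.discriminantQuad nondegenerate_nikulinForm isSymm_nikulinForm isEven_nikulinForm (nikulinDiscriminantMap a) =
      ((2 : ℤ) • hyperbolicSum 3).discriminantQuad h₁ h₂ h₃ a := by
  obtain ⟨w, rfl⟩ := exists_mk_hyperbolicSum_eq 2 3 a
  rw [nikulinDiscriminantMap_mk, discriminantQuad_nikulinForm_nikulinQuadDual,
    discriminantQuad_two_smul_hyperbolicSum_mk 3 h₁ h₂ h₃, ← sub_eq_zero, ← AddCircle.coe_sub, AddCircle.coe_eq_zero_iff]
  obtain ⟨k, hk⟩ := four_dvd_nikulinQuadDefect_self w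
  rw [nikulinQuadDefect_apply, hyperbolicSum_apply_self] at hk
  refine ⟨-k, ?_⟩
  rw [zsmul_eq_mul]
  have hk' : (2 : ℚ) * (w.1 ⬝ᵥ w.2 : ℤ) + (nikulinQuadLift w ⬝ᵥ nikulinQuadLift w : ℤ) = 4 * k := by
    exact_mod_cast hk
  push_cast
  linarith

/-- **`q_N(ψ a) = -q_{U(2)³}(a)`** ("`q_N = -q_K ∘ γ`": the values `u·v mod 2ℤ` satisfy `-q = q`).
[cite: VanGeemenSarti2007, §1.10 ("`γ : A_N → A_K` with `q_N = -q_K ∘ γ`")] -/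
theorem discriminantQuad_nikulinDiscriminantMap_eq_neg (h₁ : ((2 : ℤ) • hyperbolicSum 3).Nondegenerate)
    (h₂ : ((2 : ℤ) • hyperbolicSum 3).IsSymm) (h₃ : ((2 : ℤ) • hyperbolicSum 3).IsEven)
    (a : ((2 : ℤ) • hyperbolicSum 3).discriminantGroup) :
    nikulinForm.discriminantQuad nondegenerate_nikulinForm isSymm_nikulinForm isEven_nikulinForm (nikulinDiscriminantMap a) =
      -((2 : ℤ) • hyperbolicSum 3).discriminantQuad h₁ h₂ h₃ a := by
  rw [discriminantQuad_nikulinDiscriminantMap h₁ h₂ h₃]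
  obtain ⟨w, rfl⟩ := exists_mk_hyperbolicSum_eq 2 3 a
  rw [discriminantQuad_two_smul_hyperbolicSum_mk 3 h₁ h₂ h₃, ← sub_eq_zero, ← AddCircle.coe_neg, ← AddCircle.coe_sub,
    AddCircle.coe_eq_zero_iff]
  refine ⟨w.1 ⬝ᵥ w.2, ?_⟩
  rw [zsmul_eq_mul]
  ring

/-! ### §4 `ψ : (A_{U(2)³}, b, q) ⥲ (A_N, ±b_N, ±q_N)`; van Geemen–Sarti's `γ = ψ⁻¹` with `q_N = -q_K ∘ γ` -/

/-- **`ψ` is injective** (`b_{U(2)³}` is nondegenerate). [cite: VanGeemenSarti2007, §1.10] [cite: Nikulin1980, §1.3] -/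
theorem nikulinDiscriminantMap_injective : Injective nikulinDiscriminantMap := by
  have h₁ := nondegenerate_smul_hyperbolicSum 2 3 two_ne_zero
  have h₂ := isSymm_smul_hyperbolicSum 2 3
  rw [injective_iff_map_eq_zero]
  intro a ha
  refine ((2 : ℤ) • hyperbolicSum 3).eq_zero_of_forall_discriminantBilin_eq_zero h₁ h₂ fun c ↦ ?_
  rw [← discriminantBilin_nikulinDiscriminantMap h₁ h₂, ha, map_zero, LinearMap.zero_apply]

/-- **`ψ` is bijective** (`|A_{U(2)³}| = |A_N| = 2⁶`). [cite: VanGeemenSarti2007, §1.10 ("`A_K … ≅ (ℤ/2ℤ)⁶`", "`A_N … ≅ (ℤ/2ℤ)⁶`")] -/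
theorem nikulinDiscriminantMap_bijective : Bijective nikulinDiscriminantMap := by
  haveI := nikulinForm.finite_discriminantGroup nondegenerate_nikulinForm
  refine nikulinDiscriminantMap_injective.bijective_of_nat_card_le (le_of_eq ?_)
  rw [natCard_discriminantGroup_nikulinForm, natCard_discriminantGroup_two_smul_hyperbolicSum_three]

/-- **The isomorphism `ψ : A_{U(2)³} ⥲ A_N`** (`= γ⁻¹`). [cite: VanGeemenSarti2007, §1.10] -/
def nikulinDiscriminantIso : ((2 : ℤ) • hyperbolicSum 3).discriminantGroup ≃ₗ[ℤ] nikulinForm.discriminantGroup :=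
  LinearEquiv.ofBijective nikulinDiscriminantMap nikulinDiscriminantMap_bijective

/-- `nikulinDiscriminantIso a = ψ a`. [cite: VanGeemenSarti2007, §1.10] -/
theorem nikulinDiscriminantIso_apply (a : ((2 : ℤ) • hyperbolicSum 3).discriminantGroup) :
    nikulinDiscriminantIso a = nikulinDiscriminantMap a :=
  rfl

/-- **`b_N(ψ a, ψ c) = b_{U(2)³}(a, c)` for the isomorphism.** [cite: VanGeemenSarti2007, §1.10] -/
theorem discriminantBilin_nikulinDiscriminantIso (h₁ : ((2 : ℤ) • hyperbolicSum 3).Nondegenerate)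
    (h₂ : ((2 : ℤ) • hyperbolicSum 3).IsSymm) (a c : ((2 : ℤ) • hyperbolicSum 3).discriminantGroup) :
    nikulinForm.discriminantBilin nondegenerate_nikulinForm isSymm_nikulinForm (nikulinDiscriminantIso a)
        (nikulinDiscriminantIso c) = ((2 : ℤ) • hyperbolicSum 3).discriminantBilin h₁ h₂ a c :=
  discriminantBilin_nikulinDiscriminantMap h₁ h₂ a c

/-- **`q_N(ψ a) = q_{U(2)³}(a)` for the isomorphism.** [cite: VanGeemenSarti2007, §1.10] -/
theorem discriminantQuad_nikulinDiscriminantIso (h₁ : ((2 : ℤ) • hyperbolicSum 3).Nondegenerate)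
    (h₂ : ((2 : ℤ) • hyperbolicSum 3).IsSymm) (h₃ : ((2 : ℤ) • hyperbolicSum 3).IsEven)
    (a : ((2 : ℤ) • hyperbolicSum 3).discriminantGroup) :
    nikulinForm.discriminantQuad nondegenerate_nikulinForm isSymm_nikulinForm isEven_nikulinForm (nikulinDiscriminantIso a) =
      ((2 : ℤ) • hyperbolicSum 3).discriminantQuad h₁ h₂ h₃ a :=
  discriminantQuad_nikulinDiscriminantMap h₁ h₂ h₃ a

/-- **`q_N(ψ a) = -q_{U(2)³}(a)` for the isomorphism** ("`(A_K, q_K) ≅ (A_N, -q_N)`"). [cite: VanGeemenSarti2007, §1.10] -/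
theorem discriminantQuad_nikulinDiscriminantIso_eq_neg (h₁ : ((2 : ℤ) • hyperbolicSum 3).Nondegenerate)
    (h₂ : ((2 : ℤ) • hyperbolicSum 3).IsSymm) (h₃ : ((2 : ℤ) • hyperbolicSum 3).IsEven)
    (a : ((2 : ℤ) • hyperbolicSum 3).discriminantGroup) :
    nikulinForm.discriminantQuad nondegenerate_nikulinForm isSymm_nikulinForm isEven_nikulinForm (nikulinDiscriminantIso a) =
      -((2 : ℤ) • hyperbolicSum 3).discriminantQuad h₁ h₂ h₃ a :=
  discriminantQuad_nikulinDiscriminantMap_eq_neg h₁ h₂ h₃ a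

/-- **van Geemen–Sarti: "`(A_K, q_K) ≅ (A_N, -q_N)`" (`K = U(2)³`)** — an isomorphism of finite quadratic forms
`(A_{U(2)³}, -b, -q) ⥲ (A_N, b_N, q_N)`. [cite: VanGeemenSarti2007, §1.10 ("We will see that `(A_K,q_K) ≅ (A_N,-q_N)`")] -/
theorem exists_discriminantForm_antiIso_hyperbolicSum_nikulinForm (h₁ : ((2 : ℤ) • hyperbolicSum 3).Nondegenerate)
    (h₂ : ((2 : ℤ) • hyperbolicSum 3).IsSymm) (h₃ : ((2 : ℤ) • hyperbolicSum 3).IsEven) :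
    ∃ ψ : ((2 : ℤ) • hyperbolicSum 3).discriminantGroup ≃ₗ[ℤ] nikulinForm.discriminantGroup,
      (∀ a c, nikulinForm.discriminantBilin nondegenerate_nikulinForm isSymm_nikulinForm (ψ a) (ψ c) =
          -((2 : ℤ) • hyperbolicSum 3).discriminantBilin h₁ h₂ a c) ∧
        ∀ a, nikulinForm.discriminantQuad nondegenerate_nikulinForm isSymm_nikulinForm isEven_nikulinForm (ψ a) =
          -((2 : ℤ) • hyperbolicSum 3).discriminantQuad h₁ h₂ h₃ a :=
  ⟨nikulinDiscriminantIso, discriminantBilin_nikulinDiscriminantMap_eq_neg h₁ h₂,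
    discriminantQuad_nikulinDiscriminantMap_eq_neg h₁ h₂ h₃⟩

/-- The same isomorphism is also an isometry for `+q`: `(A_{U(2)³}, b, q) ⥲ (A_N, b_N, q_N)` ("the quadratic spaces
`((ℤ/2ℤ)⁶, q_K)` and `((ℤ/2ℤ)⁶, q_N)` are isomorphic"). [cite: VanGeemenSarti2007, §1.10] -/
theorem exists_discriminantForm_iso_hyperbolicSum_nikulinForm (h₁ : ((2 : ℤ) • hyperbolicSum 3).Nondegenerate)
    (h₂ : ((2 : ℤ) • hyperbolicSum 3).IsSymm) (h₃ : ((2 : ℤ) • hyperbolicSum 3).IsEven) :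
    ∃ ψ : ((2 : ℤ) • hyperbolicSum 3).discriminantGroup ≃ₗ[ℤ] nikulinForm.discriminantGroup,
      (∀ a c, nikulinForm.discriminantBilin nondegenerate_nikulinForm isSymm_nikulinForm (ψ a) (ψ c) =
          ((2 : ℤ) • hyperbolicSum 3).discriminantBilin h₁ h₂ a c) ∧
        ∀ a, nikulinForm.discriminantQuad nondegenerate_nikulinForm isSymm_nikulinForm isEven_nikulinForm (ψ a) =
          ((2 : ℤ) • hyperbolicSum 3).discriminantQuad h₁ h₂ h₃ a :=
  ⟨nikulinDiscriminantIso, discriminantBilin_nikulinDiscriminantIso h₁ h₂, discriminantQuad_nikulinDiscriminantIso h₁ h₂ h₃⟩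

/-- **van Geemen–Sarti's `γ : A_N ⥲ A_K` (`K = U(2)³`) with "`q_N = -q_K ∘ γ`"** (`γ = ψ⁻¹`).
[cite: VanGeemenSarti2007, §1.10 ("isomorphisms `γ : A_N → A_K` with `q_N = -q_K ∘ γ`")] -/
theorem exists_vanGeemenSarti_gamma (h₁ : ((2 : ℤ) • hyperbolicSum 3).Nondegenerate)
    (h₂ : ((2 : ℤ) • hyperbolicSum 3).IsSymm) (h₃ : ((2 : ℤ) • hyperbolicSum 3).IsEven) :
    ∃ γ : nikulinForm.discriminantGroup ≃ₗ[ℤ] ((2 : ℤ) • hyperbolicSum 3).discriminantGroup,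
      ∀ n, nikulinForm.discriminantQuad nondegenerate_nikulinForm isSymm_nikulinForm isEven_nikulinForm n =
        -((2 : ℤ) • hyperbolicSum 3).discriminantQuad h₁ h₂ h₃ (γ n) := by
  refine ⟨nikulinDiscriminantIso.symm, fun n ↦ ?_⟩
  conv_lhs => rw [← nikulinDiscriminantIso.apply_symm_apply n]
  exact discriminantQuad_nikulinDiscriminantIso_eq_neg h₁ h₂ h₃ _

/-- `γ` respects the bilinear forms (with either sign): `b_K(γ n, γ n') = b_N(n, n')`. [cite: VanGeemenSarti2007, §1.10] -/
theorem exists_vanGeemenSarti_gamma_bilin (h₁ : ((2 : ℤ) • hyperbolicSum 3).Nondegenerate)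
    (h₂ : ((2 : ℤ) • hyperbolicSum 3).IsSymm) (h₃ : ((2 : ℤ) • hyperbolicSum 3).IsEven) :
    ∃ γ : nikulinForm.discriminantGroup ≃ₗ[ℤ] ((2 : ℤ) • hyperbolicSum 3).discriminantGroup,
      (∀ n n', ((2 : ℤ) • hyperbolicSum 3).discriminantBilin h₁ h₂ (γ n) (γ n') =
          nikulinForm.discriminantBilin nondegenerate_nikulinForm isSymm_nikulinForm n n') ∧
        (∀ n, ((2 : ℤ) • hyperbolicSum 3).discriminantQuad h₁ h₂ h₃ (γ n) =
          nikulinForm.discriminantQuad nondegenerate_nikulinForm isSymm_nikulinForm isEven_nikulinForm n) ∧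
        ∀ n, nikulinForm.discriminantQuad nondegenerate_nikulinForm isSymm_nikulinForm isEven_nikulinForm n =
          -((2 : ℤ) • hyperbolicSum 3).discriminantQuad h₁ h₂ h₃ (γ n) := by
  refine ⟨nikulinDiscriminantIso.symm, fun n n' ↦ ?_, fun n ↦ ?_, fun n ↦ ?_⟩
  · conv_rhs => rw [← nikulinDiscriminantIso.apply_symm_apply n, ← nikulinDiscriminantIso.apply_symm_apply n']
    exact (discriminantBilin_nikulinDiscriminantIso h₁ h₂ _ _).symm
  · conv_rhs => rw [← nikulinDiscriminantIso.apply_symm_apply n]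
    exact (discriminantQuad_nikulinDiscriminantIso h₁ h₂ h₃ _).symm
  · conv_lhs => rw [← nikulinDiscriminantIso.apply_symm_apply n]
    exact discriminantQuad_nikulinDiscriminantIso_eq_neg h₁ h₂ h₃ _

/-- **Every class of `A_N` is some `ψ(w/2) = [θ_w]`** (`ψ` is onto): the quadruple classes of Lemma 1.10 generate `A_N`.
[cite: VanGeemenSarti2007, §1.10] -/
theorem exists_mk_nikulinQuadDual_eq (y : nikulinForm.discriminantGroup) :
    ∃ w : (Fin 3 → ℤ) × (Fin 3 → ℤ), Submodule.Quotient.mk (nikulinQuadDual w) = y := by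
  obtain ⟨a, rfl⟩ := nikulinDiscriminantMap_bijective.2 y
  obtain ⟨w, rfl⟩ := exists_mk_hyperbolicSum_eq 2 3 a
  exact ⟨w, (nikulinDiscriminantMap_mk w).symm⟩

/-- **"`q_N` of the lattice `N` has values in `ℤ/2ℤ`"**: `q_N(y) = 0` or `1 mod 2ℤ` for every `y ∈ A_N`.
[cite: VanGeemenSarti2007, §2.1 ("`q_N` of the lattice `N` has values in `ℤ/2ℤ`")] -/
theorem discriminantQuad_nikulinForm_eq_zero_or_eq_one (y : nikulinForm.discriminantGroup) :
    nikulinForm.discriminantQuad nondegenerate_nikulinForm isSymm_nikulinForm isEven_nikulinForm y = 0 ∨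
      nikulinForm.discriminantQuad nondegenerate_nikulinForm isSymm_nikulinForm isEven_nikulinForm y =
        ((1 : ℚ) : AddCircle (2 : ℚ)) := by
  have h₁ := nondegenerate_smul_hyperbolicSum 2 3 two_ne_zero
  have h₂ := isSymm_smul_hyperbolicSum 2 3
  have h₃ := isEven_smul_hyperbolicSum 2 3
  obtain ⟨a, rfl⟩ := nikulinDiscriminantMap_bijective.2 y
  obtain ⟨w, rfl⟩ := exists_mk_hyperbolicSum_eq 2 3 a
  rw [discriminantQuad_nikulinDiscriminantMap h₁ h₂ h₃]
  by_cases hw : (2 : ℤ) ∣ w.1 ⬝ᵥ w.2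
  · exact Or.inl ((discriminantQuad_two_smul_hyperbolicSum_mk_eq_zero_iff 3 h₁ h₂ h₃ w).2 hw)
  · exact Or.inr ((discriminantQuad_two_smul_hyperbolicSum_mk_eq_one_iff 3 h₁ h₂ h₃ w).2 hw)

/-- **"hence `q_N = -q_N`".** [cite: VanGeemenSarti2007, §2.1 ("`q_N` … has values in `ℤ/2ℤ`, hence `q_N = -q_N`")] -/
theorem neg_discriminantQuad_nikulinForm (y : nikulinForm.discriminantGroup) :
    -nikulinForm.discriminantQuad nondegenerate_nikulinForm isSymm_nikulinForm isEven_nikulinForm y =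
      nikulinForm.discriminantQuad nondegenerate_nikulinForm isSymm_nikulinForm isEven_nikulinForm y := by
  rcases discriminantQuad_nikulinForm_eq_zero_or_eq_one y with h | h
  · rw [h, neg_zero]
  · rw [h, ← sub_eq_zero, ← AddCircle.coe_neg, ← AddCircle.coe_sub, AddCircle.coe_eq_zero_iff]
    exact ⟨-1, by norm_num⟩

/-! ### §5 With Prop. 3.14 (iv): `(A_N, q_N) ≅ (A_K, q_K)` for the Kummer lattice `K` (both `≅ q_{U(2)}^{⊕3}`) -/

/-- **The Nikulin lattice and the Kummer lattice have isomorphic discriminant forms**: composing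
`ψ_N : A_{U(2)³} ⥲ A_N` (this file) with `φ : A_{U(2)³} ⥲ A_K` (Huybrechts Prop. 3.14 (iv),
`KummerLatticeDiscriminantForm.lean`) gives `(A_N, b_N, q_N) ⥲ (A_K, b_K, q_K)`.
[cite: VanGeemenSarti2007, §1.10 ("`((ℤ/2ℤ)⁶,q_K)` and `((ℤ/2ℤ)⁶,q_N)` are isomorphic", `K = U(2)³`)] [cite: Huybrechts2016K3, Ch. 14 Prop. 3.14 (iv) ("`q_K ≃ q_{U(2)}^{⊕3}`" for the Kummer lattice)] -/
theorem exists_discriminantForm_iso_nikulinForm_kummerForm :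
    ∃ ε : nikulinForm.discriminantGroup ≃ₗ[ℤ] kummerForm.discriminantGroup,
      (∀ x y, kummerForm.discriminantBilin nondegenerate_kummerForm isSymm_kummerForm (ε x) (ε y) =
          nikulinForm.discriminantBilin nondegenerate_nikulinForm isSymm_nikulinForm x y) ∧
        ∀ x, kummerForm.discriminantQuad nondegenerate_kummerForm isSymm_kummerForm isEven_kummerForm (ε x) =
          nikulinForm.discriminantQuad nondegenerate_nikulinForm isSymm_nikulinForm isEven_nikulinForm x := by
  have h₁ := nondegenerate_smul_hyperbolicSum 2 3 two_ne_zero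
  have h₂ := isSymm_smul_hyperbolicSum 2 3
  have h₃ := isEven_smul_hyperbolicSum 2 3
  refine ⟨nikulinDiscriminantIso.symm.trans kummerDiscriminantIso, fun x y ↦ ?_, fun x ↦ ?_⟩
  · rw [LinearEquiv.trans_apply, LinearEquiv.trans_apply, discriminantBilin_kummerDiscriminantIso h₁ h₂]
    conv_rhs => rw [← nikulinDiscriminantIso.apply_symm_apply x, ← nikulinDiscriminantIso.apply_symm_apply y]
    exact (discriminantBilin_nikulinDiscriminantIso h₁ h₂ _ _).symm
  · rw [LinearEquiv.trans_apply, discriminantQuad_kummerDiscriminantIso h₁ h₂ h₃]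
    conv_rhs => rw [← nikulinDiscriminantIso.apply_symm_apply x]
    exact (discriminantQuad_nikulinDiscriminantIso h₁ h₂ h₃ _).symm

end Literature.AlgebraicGeometry.Surfaces
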